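import Literature.Barriers.CriticalPhenomena.LaceExpansionIsingGreenAsymptotics
import HarnessLib

/-!
# `LiuSlade2026_thm17` is false as stated: a refutation by the random-walk counter-family

Barrier catalogue `Literature/Barriers/CriticalPhenomena/` (D-0021), companion of
`LaceExpansionIsingDeconvolution.lean`. That file vendors Liu–Slade 2026, Theorem 1.7 twice: the
original transcription `SpreadOutIsing.LiuSlade2026_thm17`, whose `λ`-clause reads
"`∀ ε' > 0, ∃ K, ∀ L ≥ L₂, |λ(L) - 1| ≤ K L^{-(2-ε')}`", and the corrected transcription
`SpreadOutIsing.LiuSlade2026_thm1_7` (Part G there), whose `λ`-clause is at the `ε` fixed in the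
hypotheses — the `ε` of Liu–Slade's §1.2.2 ("Let `d > 2`, fix a small `ε > 0`, and let
`K_S = K_S(ε)` be the constant in the bound (1.10)"), which enters the bootstrap function (1.12)
and the bound (1.18) of Assumption 1.5, so that the printed "for any fixed `ε > 0`,
`λ_{z_c} = 1 + O(L^{-2+ε})`" of Theorem 1.7 is a statement at that `ε` (proof, §2.2:
"`λ_{z_c} = 1 + O(β)`" with `β ∝ L^{-2+ε}`). The docstring of `LiuSlade2026_thm1_7` records a
counter-family showing that the over-quantified clause makes `LiuSlade2026_thm17` false. This file
PROVES that: `not_LiuSlade2026_thm17 : ¬ LiuSlade2026_thm17`.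

## The counter-family (as in the docstring of `LiuSlade2026_thm1_7`)

At spread-out level `L` put `z_c(L) = 1 + L^{-(2-ε)}` and `G^{(L)}_z = S_{z/z_c(L)} / z_c(L)`,
where `S_μ = Σ_n μⁿ D^{*n}` is the spread-out random-walk Green function (`soGreen`). With
`h_z = δ/z_c(L)`, `K_h = 1` and `o(1) ≡ 0` the renewal equation `S_μ = δ + μ D * S_μ` is exactly
Liu–Slade's inhomogeneous convolution equation `G_z = h_z + zD * h_z * G_z` ((1.17)), and
`|h_z(x) - δ_{0,x}| = (1 - 1/z_c)δ_{0,x} ≤ L^{-(2-ε)} δ_{0,x}` is the bound (1.18): Assumption 1.5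
holds at level `ε`. Assumption 1.3 holds by the classical properties of `S_μ` proved here from the
tree's transience theorem (`summable_convPow`): `Σ_x S_1(x) = ∞` (`Σ_x D^{*n}(x) = 1` for every
`n`), `Σ_x S_μ(x) = (1-μ)⁻¹ < ∞` and `S_μ(x) ≤ μ^{‖x‖_∞/L} S_1(x) = o(|x|^{-(d-2)})` for `μ < 1`
(`D^{*n}` is supported in `‖x‖_∞ ≤ nL`), monotonicity and continuity in `μ ∈ [0,1]`
(Weierstrass M-test), and `G_1 = S_{1/z_c}/z_c ≤ S_1`. The premise (1.10) of the theorem is the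
tree's `LiuSlade2026_prop12_greenBound_holds`. The conclusion of `LiuSlade2026_thm17` then provides
`λ(L)` with `G_{z_c}(x)|x|^{d-2} → λ(L) a_d/σ²`; since `G_{z_c} = S_1/z_c` and
`S_1(x)|x|^{d-2} → a_d/σ²` (`tendsto_soGreen_one_mul_rpow_holds`, Hara 2008 / Liu–Slade (1.11)),
`λ(L) = 1/z_c(L)`, so `|λ(L) - 1| = L^{-(2-ε)}/(1 + L^{-(2-ε)}) ≥ L^{-(2-ε)}/2`, which the clause
at `ε' = ε/2` would bound by `K L^{-(2-ε/2)}`, i.e. `L^{ε/2} ≤ 2K` for all large `L` — absurd.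
(We take `d = 5`, `ρ = 1`, `ε = ε₀ ∧ 1`.)

Nothing here is a new named fact; the corrected statement `LiuSlade2026_thm1_7` and its reductions
(`LiuSlade2026_thm1_7_of_two_facts`, `Sakai2007_thm13_spreadOut_of_three_facts'`) are untouched.

## References

* Y. Liu, G. Slade, *Gaussian deconvolution and the lace expansion for spread-out models*,
  Ann. Inst. H. Poincaré Probab. Statist. (2026), arXiv:2310.07640: §1.2.1 (1.6)–(1.8) and
  Prop. 1.2 with (1.10)–(1.11); §1.2.2 ("fix a small `ε > 0`", the bootstrap function (1.12));
  Assumption 1.3; Assumption 1.5 with (1.17)–(1.18); Theorem 1.7 with (1.20)–(1.21); §2.2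
  (`λ_{z_c} = 1 + O(β)`) [LiuSlade2026]. (Equation numbers of the arXiv version held in the
  literature store.)
* T. Hara, *Decay of correlations in nearest-neighbor self-avoiding walk, percolation, lattice
  trees and animals*, Ann. Probab. 36 (2008), Thm. 1.3 (Gaussian lemma) [Hara2008].
-/

noncomputable section

namespace Literature.Barriers.CriticalPhenomena.SpreadOutIsing

open Filter Topology Finset Literature.Probability.LatticeModels
open scoped BigOperators

variable {d L : ℕ}

/-! ## Part 1. Classical properties of the spread-out Green function `S_μ` -/

/-- `S_μ` is `ℤ^d`-symmetric (each `D^{*n}` is). [cite: LiuSlade2026, §1.2.1 (D and S_μ are ℤ^d-symmetric)] -/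
theorem isZdSymmetric_soGreen (μ : ℝ) : IsZdSymmetric (soGreen d L μ) := fun π ε x =>
  tsum_congr fun n => by rw [isZdSymmetric_convPow isZdSymmetric_soStep n π ε x]

/-- A neighbour of the origin in the range-`L` graph has sup norm at most `L`. [folklore] -/
theorem supNorm_le_of_adj_zero {w : Site d} (hw : (spreadOutGraph d L).Adj 0 w) :
    Site.supNorm w ≤ L := by
  rw [spreadOutGraph_adj_iff] at hw
  rw [Site.supNorm_le_iff]
  intro i
  have h := hw.2 i
  simp only [Pi.zero_apply, zero_sub, abs_neg] at h
  have h' : ((w i).natAbs : ℤ) ≤ L := by rwa [Int.natCast_natAbs]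
  exact_mod_cast h'

/-- **Finite speed**: `D^{*n}(x) = 0` unless `‖x‖_∞ ≤ nL` (each step moves sup-distance at most
`L`). [folklore] -/
theorem convPow_soStep_eq_zero_of_lt {n : ℕ} {x : Site d} (h : n * L < Site.supNorm x) :
    convPow (soStep d L) n x = 0 := by
  induction n generalizing x with
  | zero =>
    have hx : x ≠ 0 := by
      rintro rfl
      rw [Site.supNorm_eq_zero_iff.2 rfl] at h
      exact Nat.not_lt_zero _ h
    exact delta0_of_ne_zero hx
  | succ n ih =>
    rw [convPow_succ, latticeConv_comm, latticeConv_soStep_eq_sum]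
    refine Finset.sum_eq_zero fun w hw => ?_
    have hwL : Site.supNorm w ≤ L :=
      supNorm_le_of_adj_zero ((SimpleGraph.mem_neighborFinset _ _ _).1 hw)
    have h1 := Site.supNorm_le_supNorm_sub_add x w
    have hxw : n * L < Site.supNorm (x - w) := by
      rw [add_one_mul] at h
      generalize n * L = t at h ⊢
      omega
    rw [ih hxw, mul_zero]

/-- **`D^{*n}` is a probability distribution**: `Σ_x D^{*n}(x) = 1` (`d, L ≥ 1`).
[cite: LiuSlade2026, Def. 1.1 (D is a probability distribution)] -/
theorem hasSum_convPow_soStep (hd : 1 ≤ d) (hL : 1 ≤ L) (n : ℕ) :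
    HasSum (convPow (soStep d L) n) 1 := by
  induction n with
  | zero => exact hasSum_ite_eq (0 : Site d) (1 : ℝ)
  | succ n ih =>
    have hfun : convPow (soStep d L) (n + 1) = fun x =>
        ∑ w ∈ (spreadOutGraph d L).neighborFinset 0,
          soStep d L w * convPow (soStep d L) n (x - w) := by
      funext x
      rw [convPow_succ, latticeConv_comm, latticeConv_soStep_eq_sum]
    rw [hfun]
    have hterm : ∀ w ∈ (spreadOutGraph d L).neighborFinset 0,
        HasSum (fun x => soStep d L w * convPow (soStep d L) n (x - w)) (soStep d L w * 1) :=
      fun w _ => ((Equiv.subRight w).hasSum_iff.2 ih).mul_left _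
    have h := hasSum_sum hterm
    simp only [mul_one] at h
    rwa [sum_soStep_eq_one hd hL] at h

/-- **`Σ_x S_1(x) = ∞`**: the critical (`μ = 1`) Green function is not summable (`d ≥ 3`,
`L ≥ 1`; `Σ_x Σ_{n<N} D^{*n}(x) = N` for every `N`). This is clause (i) of Liu–Slade's
Assumption 1.3 for the random walk itself. [cite: LiuSlade2026, Assumption 1.3 (i) and (1.6)] -/
theorem not_summable_soGreen_one (hd : 3 ≤ d) (hL : 1 ≤ L) : ¬Summable (soGreen d L 1) := by
  intro hs
  have hd1 : 1 ≤ d := by omega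
  have hN : ∀ N : ℕ, (N : ℝ) ≤ ∑' x, soGreen d L 1 x := by
    intro N
    have hfin : ∀ n ∈ Finset.range N, Summable (convPow (soStep d L) n) := fun n _ =>
      (hasSum_convPow_soStep hd1 hL n).summable
    calc (N : ℝ) = ∑ n ∈ Finset.range N, (1 : ℝ) := by simp
      _ = ∑ n ∈ Finset.range N, ∑' x, convPow (soStep d L) n x :=
          Finset.sum_congr rfl fun n _ => ((hasSum_convPow_soStep hd1 hL n).tsum_eq).symm
      _ = ∑' x, ∑ n ∈ Finset.range N, convPow (soStep d L) n x :=
          (Summable.tsum_finsetSum hfin).symm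
      _ ≤ ∑' x, soGreen d L 1 x := by
          refine (summable_sum hfin).tsum_le_tsum (fun x => ?_) hs
          rw [soGreen_one_eq]
          exact (summable_convPow hd hL x).sum_le_tsum _ fun n _ => convPow_nonneg n x
  obtain ⟨N, hN'⟩ := exists_nat_gt (∑' x, soGreen d L 1 x)
  exact absurd (hN N) (not_le.2 hN')

/-- **`Σ_x S_μ(x) < ∞` for `μ < 1`** (`= Σ_n μⁿ = (1-μ)⁻¹`; Tonelli for the non-negative family
`μⁿ D^{*n}(x)` on `ℕ × ℤ^d`). Clause (ii), first half, of Assumption 1.3 for the random walk.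
[cite: LiuSlade2026, Assumption 1.3 (ii) and (1.6)] -/
theorem summable_soGreen_of_lt_one (hd : 1 ≤ d) (hL : 1 ≤ L) {μ : ℝ} (hμ0 : 0 ≤ μ) (hμ1 : μ < 1) :
    Summable (soGreen d L μ) := by
  set F : ℕ × Site d → ℝ := fun p => μ ^ p.1 * convPow (soStep d L) p.1 p.2 with hF
  have hF0 : 0 ≤ F := fun p => mul_nonneg (pow_nonneg hμ0 _) (convPow_nonneg _ _)
  have hFs : Summable F := by
    refine (summable_prod_of_nonneg hF0).2 ⟨fun n => ?_, ?_⟩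
    · exact ((hasSum_convPow_soStep hd hL n).mul_left (μ ^ n)).summable
    · have h : (fun n => ∑' x, F (n, x)) = fun n => μ ^ n := by
        funext n
        exact ((hasSum_convPow_soStep hd hL n).mul_left (μ ^ n)).tsum_eq.trans (mul_one _)
      rw [h]
      exact summable_geometric_of_lt_one hμ0 hμ1
  exact hFs.prod_symm.prod

/-- The terms `μⁿ D^{*n}(x)` are summable in `n` for `0 ≤ μ ≤ 1` (transience, `d ≥ 3`, `L ≥ 1`).
[cite: LiuSlade2026, (1.6) (S_μ for d > 2)] -/
theorem summable_soGreen_terms_of_le_one (hd : 3 ≤ d) (hL : 1 ≤ L) {μ : ℝ} (hμ0 : 0 ≤ μ)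
    (hμ1 : μ ≤ 1) (x : Site d) : Summable fun n : ℕ => μ ^ n * convPow (soStep d L) n x :=
  Summable.of_nonneg_of_le (fun n => mul_nonneg (pow_nonneg hμ0 n) (convPow_nonneg n x))
    (fun n => mul_le_of_le_one_left (convPow_nonneg n x) (pow_le_one₀ hμ0 hμ1))
    (summable_convPow hd hL x)

/-- **`S_μ(x) ≤ μ^{‖x‖_∞/L} S_1(x)`** for `0 ≤ μ ≤ 1`: the walk needs at least `‖x‖_∞/L` steps to
reach `x`. [folklore] -/
theorem soGreen_le_pow_mul_soGreen_one (hd : 3 ≤ d) (hL : 1 ≤ L) {μ : ℝ} (hμ0 : 0 ≤ μ)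
    (hμ1 : μ ≤ 1) (x : Site d) :
    soGreen d L μ x ≤ μ ^ (Site.supNorm x / L) * soGreen d L 1 x := by
  have hs1 := summable_convPow hd hL x
  have hvan : ∀ n, n < Site.supNorm x / L → convPow (soStep d L) n x = 0 := by
    intro n hn
    refine convPow_soStep_eq_zero_of_lt ?_
    have h1 : (n + 1) * L ≤ Site.supNorm x :=
      (Nat.mul_le_mul_right L (Nat.succ_le_of_lt hn)).trans (Nat.div_mul_le_self _ _)
    rw [add_one_mul] at h1
    generalize n * L = t at h1 ⊢
    omega
  have hle : ∀ n, μ ^ n * convPow (soStep d L) n x ≤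
      μ ^ (Site.supNorm x / L) * convPow (soStep d L) n x := by
    intro n
    rcases lt_or_ge n (Site.supNorm x / L) with hn | hn
    · rw [hvan n hn, mul_zero, mul_zero]
    · exact mul_le_mul_of_nonneg_right (pow_le_pow_of_le_one hμ0 hμ1 hn) (convPow_nonneg n x)
  calc soGreen d L μ x = ∑' n, μ ^ n * convPow (soStep d L) n x := rfl
    _ ≤ ∑' n, μ ^ (Site.supNorm x / L) * convPow (soStep d L) n x :=
        (summable_soGreen_terms_of_le_one hd hL hμ0 hμ1 x).tsum_le_tsum hle (hs1.mul_left _)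
    _ = μ ^ (Site.supNorm x / L) * soGreen d L 1 x := by rw [tsum_mul_left, soGreen_one_eq]

/-- The sup norm tends to infinity along the cofinite filter of `ℤ^d`. [folklore] -/
theorem tendsto_supNorm_cofinite : Tendsto (fun x : Site d => Site.supNorm x) cofinite atTop := by
  have h1 : Tendsto (fun x : Site d => ‖x‖) cofinite atTop := by
    rw [← cocompact_eq_cofinite (Site d)]
    exact tendsto_norm_cocompact_atTop
  have h2 : Tendsto (fun x : Site d => (Site.supNorm x : ℝ)) cofinite atTop :=
    h1.congr fun x => Site.norm_eq_supNorm x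
  exact tendsto_natCast_atTop_iff.1 h2

/-- `‖x‖_∞ / L → ∞` along the cofinite filter (`L ≥ 1`). [folklore] -/
theorem tendsto_supNorm_div_cofinite (hL : 1 ≤ L) :
    Tendsto (fun x : Site d => Site.supNorm x / L) cofinite atTop := by
  refine tendsto_atTop.2 fun b => ?_
  filter_upwards [tendsto_supNorm_cofinite.eventually_ge_atTop (b * L)] with x hx
  exact (Nat.le_div_iff_mul_le (by omega)).2 hx

/-- **`S_μ(x) = o(|x|^{-(d-2)})` for `μ < 1`** (`d ≥ 3`, `L ≥ 1`): from
`S_μ(x) ≤ μ^{‖x‖_∞/L} S_1(x)` and the boundedness of `S_1(x)|x|^{d-2}` (its convergence to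
`a_d/σ²`). Clause (ii), second half, of Assumption 1.3 for the random walk.
[cite: LiuSlade2026, Assumption 1.3 (ii) and (1.11)] -/
theorem tendsto_soGreen_mul_rpow_of_lt_one (hd : 3 ≤ d) (hL : 1 ≤ L) {μ : ℝ} (hμ0 : 0 ≤ μ)
    (hμ1 : μ < 1) :
    Tendsto (fun x : Site d => soGreen d L μ x * euclidNorm x ^ ((d : ℝ) - 2)) cofinite (𝓝 0) := by
  have hpow : Tendsto (fun x : Site d => μ ^ (Site.supNorm x / L)) cofinite (𝓝 0) :=
    (tendsto_pow_atTop_nhds_zero_of_lt_one hμ0 hμ1).comp (tendsto_supNorm_div_cofinite hL)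
  have hprod := hpow.mul (tendsto_soGreen_one_mul_rpow_holds hd hL)
  rw [zero_mul] at hprod
  refine squeeze_zero' (Eventually.of_forall fun x => ?_) (Eventually.of_forall fun x => ?_) hprod
  · exact mul_nonneg (soGreen_nonneg hμ0 x) (Real.rpow_nonneg (euclidNorm_nonneg x) _)
  · calc soGreen d L μ x * euclidNorm x ^ ((d : ℝ) - 2)
        ≤ μ ^ (Site.supNorm x / L) * soGreen d L 1 x * euclidNorm x ^ ((d : ℝ) - 2) :=
          mul_le_mul_of_nonneg_right (soGreen_le_pow_mul_soGreen_one hd hL hμ0 hμ1.le x)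
            (Real.rpow_nonneg (euclidNorm_nonneg x) _)
      _ = μ ^ (Site.supNorm x / L) * (soGreen d L 1 x * euclidNorm x ^ ((d : ℝ) - 2)) := by ring

/-- **`S_μ(x)` is non-decreasing in `μ ∈ [0,1]`** (`d ≥ 3`, `L ≥ 1`). Clause (iii) of
Assumption 1.3 for the random walk. [cite: LiuSlade2026, Assumption 1.3 (iii) and (1.6)] -/
theorem soGreen_mono (hd : 3 ≤ d) (hL : 1 ≤ L) {μ₁ μ₂ : ℝ} (h0 : 0 ≤ μ₁) (h12 : μ₁ ≤ μ₂)
    (h1 : μ₂ ≤ 1) (x : Site d) : soGreen d L μ₁ x ≤ soGreen d L μ₂ x :=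
  (summable_soGreen_terms_of_le_one hd hL h0 (h12.trans h1) x).tsum_le_tsum
    (fun n => mul_le_mul_of_nonneg_right (pow_le_pow_left₀ h0 h12 n) (convPow_nonneg n x))
    (summable_soGreen_terms_of_le_one hd hL (h0.trans h12) h1 x)

/-- **`μ ↦ S_μ(x)` is continuous on `[0,1]`** (`d ≥ 3`, `L ≥ 1`; Weierstrass `M`-test with the
majorant `D^{*n}(x)`, summable by transience). Clause (iii) of Assumption 1.3 for the random walk.
[cite: LiuSlade2026, Assumption 1.3 (iii) and (1.6)] -/
theorem continuousOn_soGreen (hd : 3 ≤ d) (hL : 1 ≤ L) (x : Site d) :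
    ContinuousOn (fun μ : ℝ => soGreen d L μ x) (Set.Icc 0 1) := by
  have hs := summable_convPow hd hL x
  unfold soGreen
  refine continuousOn_tsum (fun n => ?_) hs fun n μ hμ => ?_
  · exact ((continuous_pow n).mul continuous_const).continuousOn
  · rw [Real.norm_eq_abs, abs_mul, abs_of_nonneg (convPow_nonneg n x), abs_pow, abs_of_nonneg hμ.1]
    exact mul_le_of_le_one_left (convPow_nonneg n x) (pow_le_one₀ hμ.1 hμ.2)

/-- `(D * S_μ)(x) = Σ_n μⁿ D^{*(n+1)}(x)` for `0 ≤ μ ≤ 1` (the convolution with the finitely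
supported `D` is a finite sum, which commutes with the series). [cite: LiuSlade2026, (1.6)–(1.7)] -/
theorem latticeConv_soStep_soGreen (hd : 3 ≤ d) (hL : 1 ≤ L) {μ : ℝ} (hμ0 : 0 ≤ μ) (hμ1 : μ ≤ 1)
    (x : Site d) :
    latticeConv (soStep d L) (soGreen d L μ) x = ∑' n, μ ^ n * convPow (soStep d L) (n + 1) x := by
  rw [latticeConv_soStep_eq_sum]
  have hsum : ∀ w ∈ (spreadOutGraph d L).neighborFinset 0,
      Summable fun n => soStep d L w * (μ ^ n * convPow (soStep d L) n (x - w)) := fun w _ =>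
    (summable_soGreen_terms_of_le_one hd hL hμ0 hμ1 (x - w)).mul_left _
  calc ∑ w ∈ (spreadOutGraph d L).neighborFinset 0, soStep d L w * soGreen d L μ (x - w)
      = ∑ w ∈ (spreadOutGraph d L).neighborFinset 0,
          ∑' n, soStep d L w * (μ ^ n * convPow (soStep d L) n (x - w)) :=
        Finset.sum_congr rfl fun w _ => tsum_mul_left.symm
    _ = ∑' n, ∑ w ∈ (spreadOutGraph d L).neighborFinset 0,
          soStep d L w * (μ ^ n * convPow (soStep d L) n (x - w)) :=
        (Summable.tsum_finsetSum hsum).symm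
    _ = ∑' n, μ ^ n * convPow (soStep d L) (n + 1) x := by
        refine tsum_congr fun n => ?_
        rw [convPow_succ, latticeConv_comm, latticeConv_soStep_eq_sum, Finset.mul_sum]
        exact Finset.sum_congr rfl fun w _ => by ring

/-- **The renewal equation `S_μ = δ + μ D * S_μ`** for `0 ≤ μ ≤ 1` (`d ≥ 3`, `L ≥ 1`): `S_μ`
solves `(δ - μD) * S_μ = δ`. [cite: LiuSlade2026, (1.6)–(1.7) (S_μ is the solution of (δ - μD) * S_μ = δ)] -/
theorem soGreen_eq_delta0_add (hd : 3 ≤ d) (hL : 1 ≤ L) {μ : ℝ} (hμ0 : 0 ≤ μ) (hμ1 : μ ≤ 1)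
    (x : Site d) :
    soGreen d L μ x = delta0 x + μ * latticeConv (soStep d L) (soGreen d L μ) x := by
  rw [latticeConv_soStep_soGreen hd hL hμ0 hμ1 x, ← tsum_mul_left, soGreen,
    (summable_soGreen_terms_of_le_one hd hL hμ0 hμ1 x).tsum_eq_zero_add]
  congr 1
  · rw [pow_zero, one_mul]
    rfl
  · exact tsum_congr fun n => by ring

/-! ## Part 2. The counter-family `G_z = S_{z/z_c}/z_c` (a rescaled random walk, `z_c ≥ 1`) -/

/-- `z/z_c ∈ [0,1]` for `z ∈ [1, z_c]`, `z_c ≥ 1`. [folklore] -/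
theorem div_mem_unit_of_mem_Icc {zc z : ℝ} (hzc : 1 ≤ zc) (hz : z ∈ Set.Icc 1 zc) :
    0 ≤ z / zc ∧ z / zc ≤ 1 :=
  have hzc0 : 0 < zc := lt_of_lt_of_le one_pos hzc
  ⟨div_nonneg (zero_le_one.trans hz.1) hzc0.le, (div_le_one hzc0).2 hz.2⟩

/-- Convolution with `δ/c` from the left divides by `c`: `((δ/c) * g)(y) = g(y)/c`. [folklore] -/
theorem latticeConv_delta0_div (c : ℝ) (g : Site d → ℝ) (y : Site d) :
    latticeConv (fun u => delta0 u / c) g y = g y / c := by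
  show ∑' u, delta0 u / c * g (y - u) = g y / c
  rw [tsum_eq_single 0 fun u hu => by rw [delta0_of_ne_zero hu, zero_div, zero_mul]]
  rw [delta0_zero, sub_zero]
  ring

/-- `D * (g/c) = (D * g)/c` (a finite sum). [folklore] -/
theorem latticeConv_soStep_div (g : Site d → ℝ) (c : ℝ) (x : Site d) :
    latticeConv (soStep d L) (fun y => g y / c) x = latticeConv (soStep d L) g x / c := by
  rw [latticeConv_soStep_eq_sum, latticeConv_soStep_eq_sum, Finset.sum_div]
  exact Finset.sum_congr rfl fun w _ => by ring

/-- **Liu–Slade's Assumption 1.3 holds for the rescaled random-walk family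
`G_z = S_{z/z_c}/z_c`, `z ∈ [1, z_c]`**, for every `z_c ≥ 1` (`d ≥ 3`, `L ≥ 1`): `z_c ≥ 1`,
symmetry, positivity, (i) `Σ_x S_1/z_c = ∞`, (ii) summability and `o(|x|^{-(d-2)})` decay of
`S_μ`, `μ = z/z_c < 1`, (iii) monotonicity and continuity in `z`, (iv) `G_1 = S_{1/z_c}/z_c ≤ S_1`.
[cite: LiuSlade2026, Assumption 1.3] -/
theorem lsAssumptionG_rwFamily (hd : 3 ≤ d) (hL : 1 ≤ L) {zc : ℝ} (hzc1 : 1 ≤ zc) :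
    LSAssumptionG d L (fun z x => soGreen d L (z / zc) x / zc) zc := by
  have hd1 : 1 ≤ d := by omega
  have hzc : 0 < zc := lt_of_lt_of_le one_pos hzc1
  refine ⟨hzc1, fun z _ π e x => ?_, fun z hz x => ?_, ?_, ?_, ?_, ?_, ?_, ?_⟩
  · -- symmetry
    show soGreen d L (z / zc) (Site.signedPerm π e x) / zc = soGreen d L (z / zc) x / zc
    rw [isZdSymmetric_soGreen (z / zc) π e x]
  · -- nonnegativity
    exact div_nonneg (soGreen_nonneg (div_mem_unit_of_mem_Icc hzc1 hz).1 x) hzc.le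
  · -- (i) `Σ_x G_{z_c}(x) = ∞`
    intro hs
    refine not_summable_soGreen_one hd hL ?_
    have hfun : soGreen d L 1 = fun x => soGreen d L (zc / zc) x / zc * zc := by
      funext x
      rw [div_self hzc.ne', div_mul_cancel₀ _ hzc.ne']
    rw [hfun]
    exact hs.mul_right _
  · -- (ii) summability below `z_c`
    intro z hz
    have hμ0 : 0 ≤ z / zc := div_nonneg (zero_le_one.trans hz.1) hzc.le
    have hμ1 : z / zc < 1 := (div_lt_one hzc).2 hz.2
    exact (summable_soGreen_of_lt_one hd1 hL hμ0 hμ1).div_const _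
  · -- (ii) decay below `z_c`
    intro z hz
    have hμ0 : 0 ≤ z / zc := div_nonneg (zero_le_one.trans hz.1) hzc.le
    have hμ1 : z / zc < 1 := (div_lt_one hzc).2 hz.2
    have h := (tendsto_soGreen_mul_rpow_of_lt_one hd hL hμ0 hμ1).div_const zc
    rw [zero_div] at h
    refine h.congr fun x => ?_
    show soGreen d L (z / zc) x * euclidNorm x ^ ((d : ℝ) - 2) / zc =
      soGreen d L (z / zc) x / zc * euclidNorm x ^ ((d : ℝ) - 2)
    ring
  · -- (iii) monotonicity
    intro x z₁ hz₁ z₂ hz₂ h12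
    exact div_le_div_of_nonneg_right
      (soGreen_mono hd hL (div_mem_unit_of_mem_Icc hzc1 hz₁).1
        (div_le_div_of_nonneg_right h12 hzc.le) (div_mem_unit_of_mem_Icc hzc1 hz₂).2 x) hzc.le
  · -- (iii) continuity
    intro x
    have hc := continuousOn_soGreen hd hL x
    have hcomp : ContinuousOn (fun z : ℝ => soGreen d L (z / zc) x) (Set.Icc 1 zc) :=
      hc.comp (continuousOn_id.div_const _) fun z hz =>
        ⟨(div_mem_unit_of_mem_Icc hzc1 hz).1, (div_mem_unit_of_mem_Icc hzc1 hz).2⟩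
    exact hcomp.div_const _
  · -- (iv) `G_1 ≤ S_1`
    intro x
    have h1 : (1 : ℝ) ∈ Set.Icc 1 zc := ⟨le_rfl, hzc1⟩
    obtain ⟨h10, h11⟩ := div_mem_unit_of_mem_Icc hzc1 h1
    have hS0 : 0 ≤ soGreen d L (1 / zc) x := soGreen_nonneg h10 x
    calc soGreen d L (1 / zc) x / zc ≤ soGreen d L (1 / zc) x := div_le_self hS0 hzc1
      _ ≤ soGreen d L 1 x := soGreen_le_soGreen_one h10 h11 (summable_convPow hd hL x)

/-- **Liu–Slade's Assumption 1.5 holds for the rescaled random-walk family at level `ε`**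
whenever `z_c - 1 ≤ L^{-(2-ε)}` (`z_c ≥ 1`, `d ≥ 3`, `L ≥ 1`, any `ρ`, any `K_S`; the bootstrap
hypothesis is not used), with `h_z = δ/z_c`, `K_h = 1` and `o(1) ≡ 0`: the convolution equation
`G_z = h_z + zD * h_z * G_z` is the renewal equation of `S_{z/z_c}`, and
`|h_z - δ| = (1 - 1/z_c)δ ≤ (z_c - 1)δ ≤ L^{-(2-ε)} δ`.
[cite: LiuSlade2026, Assumption 1.5, (1.17)–(1.18)] -/
theorem lsAssumptionH_rwFamily (hd : 3 ≤ d) (hL : 1 ≤ L) {ε zc : ℝ} (hzc1 : 1 ≤ zc)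
    (hzcL : zc - 1 ≤ (L : ℝ) ^ (-(2 - ε))) (K_S ρ : ℝ) :
    LSAssumptionH d L ε K_S ρ 1 0 (fun z x => soGreen d L (z / zc) x / zc) zc := by
  intro z hz _
  have hzc : 0 < zc := lt_of_lt_of_le one_pos hzc1
  obtain ⟨hμ0, hμ1⟩ := div_mem_unit_of_mem_Icc hzc1 hz
  refine ⟨fun x => delta0 x / zc, fun π e x => ?_, fun x => ?_, fun x => ?_⟩
  · -- symmetry of `h`
    show delta0 (Site.signedPerm π e x) / zc = delta0 x / zc
    rw [isZdSymmetric_delta0 π e x]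
  · -- the convolution equation
    have hinner : latticeConv (fun u => delta0 u / zc) (fun y => soGreen d L (z / zc) y / zc) =
        fun y => soGreen d L (z / zc) y / zc / zc := by
      funext y
      rw [latticeConv_delta0_div]
    show soGreen d L (z / zc) x / zc = delta0 x / zc + z * latticeConv (soStep d L)
      (latticeConv (fun u => delta0 u / zc) (fun y => soGreen d L (z / zc) y / zc)) x
    rw [hinner, latticeConv_soStep_div, latticeConv_soStep_div,
      soGreen_eq_delta0_add hd hL hμ0 hμ1 x]
    ring
  · -- the bound (1.18) with `K_h = 1`, `o(1) = 0`
    show |delta0 x / zc - delta0 x| ≤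
      1 * (L : ℝ) ^ (-(2 - ε)) * (delta0 x + 0 / jnorm x ^ ((d : ℝ) + 2 + ρ))
    rw [zero_div, add_zero, one_mul]
    by_cases hx : x = 0
    · subst hx
      rw [delta0_zero, mul_one]
      have hsub : 1 / zc - 1 = -((zc - 1) / zc) := by
        rw [div_sub_one hzc.ne', ← neg_div, neg_sub]
      rw [hsub, abs_neg, abs_of_nonneg (div_nonneg (by linarith) hzc.le)]
      exact (div_le_self (by linarith) hzc1).trans hzcL
    · rw [delta0_of_ne_zero hx, zero_div, sub_zero, abs_zero, mul_zero]

/-! ## Part 3. The refutation -/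

/-- **`LiuSlade2026_thm17` is false.** Apply it with `d = 5`, `ρ = 1`, `ε = ε₀ ∧ 1`, the constant
`K_S` of `LiuSlade2026_prop12_greenBound_holds`, and the counter-family
`G^{(L)}_z = S_{z/z_c(L)}/z_c(L)`, `z_c(L) = 1 + L^{-(2-ε)}` of Part 2 (`K_h = 1`, `η ≡ 0`): the
asymptotics `S_1(x)|x|^{d-2} → a_d/σ²` force `λ(L) = 1/z_c(L)`, whence
`|λ(L) - 1| ≥ L^{-(2-ε)}/2`, incompatible with the `λ`-clause at `ε' = ε/2` for large `L`. The
corrected statement is `LiuSlade2026_thm1_7`. [cite: LiuSlade2026, Theorem 1.7 and §1.2.2 ("fix a small ε > 0"), §2.2 (λ_{z_c} = 1 + O(β), β ∝ L^{-2+ε})] -/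
theorem not_LiuSlade2026_thm17 : ¬LiuSlade2026_thm17 := by
  intro h
  have hd3 : 3 ≤ 5 := by norm_num
  have hρ : max ((((5 : ℕ) : ℝ) - 8) / 2) 0 < (1 : ℝ) := by
    rw [max_lt_iff]; norm_num
  obtain ⟨ε₀, hε₀, H⟩ := h 5 (by norm_num) 1 hρ
  set ε : ℝ := min ε₀ 1 with hεdef
  have hε : 0 < ε := lt_min hε₀ one_pos
  have hεε₀ : ε ≤ ε₀ := min_le_left _ _
  have hε1 : ε ≤ 1 := min_le_right _ _
  obtain ⟨K_S, hKS, L₀, hS⟩ := LiuSlade2026_prop12_greenBound_holds 5 (by norm_num) ε hε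
  -- the counter-family `G^{(L)}_z = S_{z/z_c(L)}/z_c(L)`, `z_c(L) = 1 + L^{-(2-ε)}`
  set zc : ℕ → ℝ := fun L => 1 + (L : ℝ) ^ (-(2 - ε)) with hzc_def
  have hzcL : ∀ L : ℕ, zc L - 1 = (L : ℝ) ^ (-(2 - ε)) := fun L => by
    simp only [hzc_def, add_sub_cancel_left]
  have hzc1 : ∀ L : ℕ, 1 ≤ zc L := fun L => by
    have h0 : 0 ≤ (L : ℝ) ^ (-(2 - ε)) := Real.rpow_nonneg (Nat.cast_nonneg L) _
    linarith [hzcL L]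
  obtain ⟨L₂, lam, hlam, hmain⟩ := H ε hε hεε₀ K_S hKS ⟨L₀, hS⟩
    (fun L z x => soGreen 5 L (z / zc L) x / zc L) zc 1 (fun _ => 0) tendsto_const_nhds
    ⟨1, fun L hL => ⟨lsAssumptionG_rwFamily hd3 hL (hzc1 L),
      lsAssumptionH_rwFamily hd3 hL (hzc1 L) (hzcL L).le K_S 1⟩⟩
  obtain ⟨K, hK⟩ := hlam (ε / 2) (half_pos hε)
  -- Step 1: `λ(L) = 1/z_c(L)` for `L ≥ L₂ ∨ 1`
  have hlamL : ∀ L : ℕ, L₂ ≤ L → 1 ≤ L → lam L = (zc L)⁻¹ := by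
    intro L hL2 hL1
    obtain ⟨hlim, -⟩ := hmain L hL2
    have hzc : 0 < zc L := lt_of_lt_of_le one_pos (hzc1 L)
    have hc0 : 0 < gaussianAmp 5 / soVariance 5 L :=
      div_pos (gaussianAmp_pos (by norm_num)) (soVariance_pos (by norm_num) hL1)
    have hlim' : Tendsto (fun x : Site 5 => soGreen 5 L (zc L / zc L) x / zc L *
        euclidNorm x ^ (((5 : ℕ) : ℝ) - 2)) cofinite
        (𝓝 (gaussianAmp 5 / soVariance 5 L / zc L)) := by
      have h1 := (tendsto_soGreen_one_mul_rpow_holds (d := 5) (L := L) hd3 hL1).div_const (zc L)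
      refine h1.congr fun x => ?_
      rw [div_self hzc.ne']
      ring
    have huniq := tendsto_nhds_unique hlim hlim'
    -- `huniq : lam L * a_5 / σ² = (a_5/σ²) / z_c`
    rw [mul_div_assoc] at huniq
    have h2 : lam L * (gaussianAmp 5 / soVariance 5 L) =
        (zc L)⁻¹ * (gaussianAmp 5 / soVariance 5 L) := by
      rw [huniq]
      ring
    exact mul_right_cancel₀ hc0.ne' h2
  -- Step 2: `L^{ε/2} ≤ 2K` for all large `L`, which is absurd
  have hbig : Tendsto (fun L : ℕ => ((L : ℝ)) ^ (ε / 2)) atTop atTop :=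
    (tendsto_rpow_atTop (half_pos hε)).comp tendsto_natCast_atTop_atTop
  obtain ⟨L, hLK, hLge⟩ :=
    ((hbig.eventually_gt_atTop (2 * K)).and (eventually_ge_atTop (max L₂ 1))).exists
  have hL2 : L₂ ≤ L := le_of_max_le_left hLge
  have hL1 : 1 ≤ L := le_of_max_le_right hLge
  have hL1' : (1 : ℝ) ≤ L := by exact_mod_cast hL1
  have hLpos : (0 : ℝ) < L := by linarith
  have hKL := hK L hL2
  rw [hlamL L hL2 hL1] at hKL
  set t : ℝ := (L : ℝ) ^ (-(2 - ε)) with ht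
  set u : ℝ := (L : ℝ) ^ (ε / 2) with hu
  have ht0 : 0 < t := Real.rpow_pos_of_pos hLpos _
  have ht1 : t ≤ 1 := Real.rpow_le_one_of_one_le_of_nonpos hL1' (by linarith)
  have hu0 : 0 < u := Real.rpow_pos_of_pos hLpos _
  have hzc_eq : zc L = 1 + t := by linarith [hzcL L]
  have habs : |(zc L)⁻¹ - 1| = t / (1 + t) := by
    rw [hzc_eq, abs_sub_comm]
    have e : 1 - (1 + t)⁻¹ = t / (1 + t) := by field_simp; ring
    rw [e, abs_of_nonneg (div_nonneg ht0.le (by linarith))]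
  have hsplit : (L : ℝ) ^ (-(2 - ε / 2)) = t * u⁻¹ := by
    rw [ht, hu, ← Real.rpow_neg hLpos.le, ← Real.rpow_add hLpos]
    congr 1
    ring
  rw [habs, hsplit] at hKL
  -- `t/2 ≤ t/(1+t) ≤ K t/u`, so `u ≤ 2K`
  have h3 : t / 2 ≤ K * (t * u⁻¹) :=
    (div_le_div_of_nonneg_left ht0.le (by linarith) (by linarith)).trans hKL
  have h5 : t * u ≤ t * (2 * K) := by
    have h4 := mul_le_mul_of_nonneg_right h3 (by positivity : (0 : ℝ) ≤ 2 * u)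
    calc t * u = t / 2 * (2 * u) := by ring
      _ ≤ K * (t * u⁻¹) * (2 * u) := h4
      _ = t * (2 * K) := by field_simp
  have h6 : u ≤ 2 * K := le_of_mul_le_mul_left h5 ht0
  linarith

end Literature.Barriers.CriticalPhenomena.SpreadOutIsing

end
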